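import Literature.MathematicalPhysics.QuantumLattice.GrassmannGaussConvBinomialGram
import Literature.MathematicalPhysics.QuantumLattice.GrassmannSupportSplit
import Literature.MathematicalPhysics.QuantumLattice.GrassmannRelabelling
import Literature.MathematicalPhysics.QuantumLattice.GrassmannLaplacianGramBound
import Literature.MathematicalPhysics.QuantumLattice.GrassmannPairLaplacians
import Literature.Probability.LatticeModels.SubmultiplicativeTreeWeight
import HarnessLib

/-!
# The linear part `e^{Δ_C} H − H` against an ADMISSIBLE CONSTANT: an interaction touching a zone is suppressed at deep pins (binomial–Gram form)

Topic `MathematicalPhysics/QuantumLattice`; the zone form of `GrassmannGaussConvBinomialGram.sum_norm_kernel_gaussConv_sub_le_binomial_of_gramBounded`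
(Benfatto–Giuliani–Mastropietro 2006, (2.61)–(2.63), (2.77)–(2.80) with the decay bookkeeping of §3 (3.2)–(3.8)) and the first-order companion of
`GrassmannEffectiveActionGradedZoneLipschitzDB` (orders `≥ 2`).  If every kernel of the even `H` is supported on label families touching a zone `Z`, and the
output pin `w` is such that `Λ ≤ wt S` for every label set `S ∋ w` meeting `Z` (tree weight `wt`), then the UNWEIGHTED first-order kernels at strings
containing `w` gain the factor `Λ⁻¹` from the WEIGHTED profile of `H`: only the monomials of `H` containing the label `w` contribute to output strings
containing `w` (the others lie in the subalgebra of the fields `≠ w`, which `e^{Δ_C}` preserves — `gaussConv_mem_fieldSubalgebra` — and whose kernels vanish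
at strings through `w`), and every such monomial contains `w` and meets `Z`, so its weight is `≥ Λ`.

* `kernel_eq_zero_of_mem_fieldSubalgebra` — kernels of an element of `fieldSubalgebra S` vanish at label strings with a leg outside `S`;
* `supportPart_mem_fieldSubalgebra` — `supportPart P F` lies in the subalgebra of the fields satisfying `P` (`GrassmannSupportSplit`);
* **`const_mul_sum_norm_kernel_gaussConv_sub_le_binomial_zone_of_gramBounded`** —
  `Λ · Σ_{W : W_i = w} ‖kernel_{2p} (e^{Δ_C} H − H)(W)‖ ≤ Σ_{p < m' ≤ |Γ|/2} C(2m', 2p) κ^{2m'−2p} N^{wt}(m')`.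

Use: the boundary part of the difference «fine action − glued coarse action» of a nested two-volume comparison, read at deep pins (first order of the
zone bracket of the two-volume Lipschitz tower).  Everything is proved; no definition, no named fact.

## Sources

G. Benfatto, A. Giuliani, V. Mastropietro, Ann. Henri Poincaré 7 (2006) 809–898, (2.61)–(2.63), (2.77)–(2.80), §3 (3.2)–(3.8)
[`BenfattoGiulianiMastropietro2006`]; M. Salmhofer, *Renormalization: An Introduction* (Springer 1999), §4.3 (4.86)–(4.95) [`Salmhofer1999`].
-/

noncomputable section

namespace Literature.MathematicalPhysics.QuantumLattice

open GrassmannAlgebra Finset Literature.Probability.LatticeModels Literature.Probability.LatticeModels.BattleFederbush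
open scoped Nat

universe u

/-! ### Support bookkeeping -/

section Support

variable (R : Type*) [CommRing R] [Algebra ℚ R] {Γ : Type*} [Fintype Γ] [DecidableEq Γ]

/-- **Kernels of an element of the subalgebra of the fields in `S` vanish at label strings with a leg outside `S`** (move that leg to the front by a
transposition — the kernel is antisymmetric — and peel off its derivative, which kills the subalgebra). [cite: Salmhofer1999, §4.3 (4.95)] -/
theorem kernel_eq_zero_of_mem_fieldSubalgebra {S : Set Γ} {a : GrassmannAlgebra R Γ} (ha : a ∈ fieldSubalgebra R S)
    {m : ℕ} {X : Fin m → Γ} {i : Fin m} (hi : X i ∉ S) : kernel R a m X = 0 := by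
  obtain ⟨m, rfl⟩ : ∃ m', m = m' + 1 := ⟨m - 1, by have := i.pos; omega⟩
  set σ : Equiv.Perm (Fin (m + 1)) := Equiv.swap 0 i with hσ
  have hXσ : (X ∘ σ) ∘ σ = X := by
    ext j
    simp only [Function.comp_apply, hσ, Equiv.swap_apply_self]
  have hX : kernel R a (m + 1) X = ((Equiv.Perm.sign σ : ℤ) : R) * kernel R a (m + 1) (X ∘ σ) := by
    have h := kernel_comp_perm R a (m + 1) (X ∘ σ) σ
    rwa [hXσ] at h
  have h0 : grassmannDeriv R ((X ∘ σ) 0) a = 0 := by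
    rw [show (X ∘ σ) 0 = X i by simp [hσ]]
    exact grassmannDeriv_eq_zero_of_mem_fieldSubalgebra R hi ha
  rw [hX, kernel_def, iterDeriv_succ_apply, h0, map_zero, map_zero, mul_zero, mul_zero]

/-- The support part lies in the subalgebra of the fields of the region. [cite: Salmhofer1999, §4.3 (4.95)] -/
theorem supportPart_mem_fieldSubalgebra (P : Γ → Prop) [DecidablePred P] (F : GrassmannAlgebra R Γ) :
    supportPart R P F ∈ fieldSubalgebra R {x : Γ | P x} := by
  unfold supportPart
  refine Subalgebra.sum_mem _ fun m _ => ?_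
  simp only [presented]
  refine Subalgebra.sum_mem _ fun Y _ => ?_
  by_cases h : ∀ j, P (Y j)
  · rw [if_pos h]
    exact Subalgebra.smul_mem _ (fieldSubalgebra_mono R (by rintro x ⟨j, rfl⟩; exact h j) (genProd_mem_fieldSubalgebra_range R Y)) _
  · rw [if_neg h, zero_smul]
    exact zero_mem _

end Support

/-! ### The zone form of the binomial–Gram first order -/

section Zone

variable {𝕜 : Type*} [RCLike 𝕜] {Γ : Type u} [Fintype Γ] [DecidableEq Γ] {wt : Finset Γ → ℝ} (C : Matrix Γ Γ 𝕜)

omit [Fintype Γ] [DecidableEq Γ] in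
/-- Kernels of a difference. [folklore] -/
private theorem kernel_sub_eq_zone (A B : GrassmannAlgebra 𝕜 Γ) (m : ℕ) (X : Fin m → Γ) :
    kernel 𝕜 (A - B) m X = kernel 𝕜 A m X - kernel 𝕜 B m X := by
  rw [sub_eq_add_neg, kernel_add, ← neg_one_smul 𝕜 B, kernel_smul, neg_one_mul, ← sub_eq_add_neg]

/-- **`e^{Δ_C} H − H` AGAINST AN ADMISSIBLE CONSTANT (interaction touching a zone, output pinned far from it), binomial–Gram form** (BGM 2006
(2.61)–(2.63), (2.77)–(2.80), §3): `C` replica-Gram-bounded with constant `κ ≥ 0`, `H` even with `wt`-weighted pinned profile `N(m')` in degree `2m'`,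
every kernel of `H` supported on label families touching `Z`, and `Λ ≥ 0` with `Λ ≤ wt S` for all `S ∋ w` meeting `Z`: in every even degree `2p`, the output
slot `i` pinned at `w` and the others summed without weight,
`Λ · Σ_{W : W_i = w} ‖kernel_{2p} (e^{Δ_C} H − H)(W)‖ ≤ Σ_{p < m' ≤ |Γ|/2} C(2m', 2p) κ^{2m'−2p} N(m')`.
[cite: BenfattoGiulianiMastropietro2006, (2.61)-(2.63) and (2.77)-(2.80)] -/
theorem const_mul_sum_norm_kernel_gaussConv_sub_le_binomial_zone_of_gramBounded (hwt : IsTreeWeight wt) {κ : ℝ} (hκ : 0 ≤ κ)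
    (hGB : IsGramBoundedR C κ) (H : GrassmannAlgebra 𝕜 Γ) (hH : H ∈ evenPart 𝕜 Γ) (N : ℕ → ℝ) (hN0 : ∀ m', 0 ≤ N m')
    (hN : ∀ m' (j : Fin (2 * m')) (a : Γ), ∑ Y ∈ univ.filter (fun Y : Fin (2 * m') → Γ => Y j = a),
      ‖kernel 𝕜 H (2 * m') Y‖ * wt (univ.image Y) ≤ N m')
    (Z : Set Γ) (hZ : ∀ (m' : ℕ) (Y : Fin (2 * m') → Γ), kernel 𝕜 H (2 * m') Y ≠ 0 → ∃ j, Y j ∈ Z)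
    (w : Γ) {Λ : ℝ} (hΛ0 : 0 ≤ Λ) (hΛ : ∀ S : Finset Γ, w ∈ S → (∃ z ∈ S, z ∈ Z) → Λ ≤ wt S)
    {p : ℕ} (i : Fin (2 * p)) :
    Λ * ∑ W ∈ univ.filter (fun W : Fin (2 * p) → Γ => W i = w), ‖kernel 𝕜 (gaussConv 𝕜 C H - H) (2 * p) W‖ ≤
      ∑ m' ∈ range (Fintype.card Γ / 2 + 1), if p < m' then ((2 * m').choose (2 * p) : ℝ) * κ ^ (2 * m' - 2 * p) * N m' else 0 := by
  -- the part of `H` whose monomials avoid the label `w`, and the rest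
  set G : GrassmannAlgebra 𝕜 Γ := supportPart 𝕜 (fun x : Γ => x ≠ w) H with hG
  set Hw : GrassmannAlgebra 𝕜 Γ := H - G with hHw
  have hGmem : G ∈ fieldSubalgebra 𝕜 {x : Γ | x ≠ w} := supportPart_mem_fieldSubalgebra 𝕜 _ H
  have hGe : G ∈ evenPart 𝕜 Γ := supportPart_mem_evenPart 𝕜 _ hH
  have hHwe : Hw ∈ evenPart 𝕜 Γ := sub_mem hH hGe
  -- (1) at output strings containing `w`, `G` and `e^{Δ_C} G` are invisible
  have hinv : ∀ W : Fin (2 * p) → Γ, W i = w →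
      kernel 𝕜 (gaussConv 𝕜 C H - H) (2 * p) W = kernel 𝕜 (gaussConv 𝕜 C Hw - Hw) (2 * p) W := by
    intro W hW
    have hWi : W i ∉ {x : Γ | x ≠ w} := by simp [hW]
    have h1 : kernel 𝕜 G (2 * p) W = 0 := kernel_eq_zero_of_mem_fieldSubalgebra 𝕜 hGmem hWi
    have h2 : kernel 𝕜 (gaussConv 𝕜 C G) (2 * p) W = 0 :=
      kernel_eq_zero_of_mem_fieldSubalgebra 𝕜 (gaussConv_mem_fieldSubalgebra 𝕜 C hGmem) hWi
    have hsplit : gaussConv 𝕜 C H - H = (gaussConv 𝕜 C Hw - Hw) + (gaussConv 𝕜 C G - G) := by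
      rw [hHw, map_sub]; abel
    rw [hsplit, kernel_add, kernel_sub_eq_zone (gaussConv 𝕜 C G) G, h1, h2, sub_zero, add_zero]
  -- (2) the unweighted profile of `Λ • Hw` is dominated by the weighted profile of `H`
  have hprof : ∀ m' (j : Fin (2 * m')) (a : Γ), ∑ Y ∈ univ.filter (fun Y : Fin (2 * m') → Γ => Y j = a),
      ‖kernel 𝕜 (((Λ : ℝ) : 𝕜) • Hw) (2 * m') Y‖ ≤ N m' := by
    intro m' j a
    refine le_trans (sum_le_sum fun Y _ => ?_) (hN m' j a)
    rw [kernel_smul, norm_mul, RCLike.norm_ofReal, abs_of_nonneg hΛ0, hHw, kernel_sub_supportPart]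
    split_ifs with hall
    · rw [norm_zero, mul_zero]
      exact mul_nonneg (norm_nonneg _) (hwt.nonneg _)
    · by_cases hk : kernel 𝕜 H (2 * m') Y = 0
      · rw [hk, norm_zero, mul_zero, zero_mul]
      · obtain ⟨j', hj'⟩ := hZ m' Y hk
        push Not at hall
        obtain ⟨j₀, hj₀⟩ := hall
        have hΛY : Λ ≤ wt (univ.image Y) :=
          hΛ _ (mem_image.2 ⟨j₀, mem_univ _, hj₀⟩) ⟨Y j', mem_image.2 ⟨j', mem_univ _, rfl⟩, hj'⟩
        rw [mul_comm]
        exact mul_le_mul_of_nonneg_left hΛY (norm_nonneg _)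
  -- (3) the binomial–Gram door for `Λ • Hw`
  have hdoor := sum_norm_kernel_gaussConv_sub_le_binomial_of_gramBounded C hκ hGB (((Λ : ℝ) : 𝕜) • Hw)
    (Subalgebra.smul_mem _ hHwe _) N hN0 hprof i w
  -- (4) assemble
  calc Λ * ∑ W ∈ univ.filter (fun W : Fin (2 * p) → Γ => W i = w), ‖kernel 𝕜 (gaussConv 𝕜 C H - H) (2 * p) W‖
      = Λ * ∑ W ∈ univ.filter (fun W : Fin (2 * p) → Γ => W i = w), ‖kernel 𝕜 (gaussConv 𝕜 C Hw - Hw) (2 * p) W‖ := by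
        congr 1
        exact sum_congr rfl fun W hW => by rw [hinv W (mem_filter.1 hW).2]
    _ = ∑ W ∈ univ.filter (fun W : Fin (2 * p) → Γ => W i = w),
          ‖kernel 𝕜 (gaussConv 𝕜 C (((Λ : ℝ) : 𝕜) • Hw) - ((Λ : ℝ) : 𝕜) • Hw) (2 * p) W‖ := by
        rw [mul_sum]
        refine sum_congr rfl fun W _ => ?_
        rw [map_smul, ← smul_sub, kernel_smul, norm_mul, RCLike.norm_ofReal, abs_of_nonneg hΛ0]
    _ ≤ _ := hdoor

end Zone

end Literature.MathematicalPhysics.QuantumLattice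

end
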